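import Literature.NumberTheory.EllipticCurves.CyclotomicTorsionCertificateSteps
import HarnessLib

/-!
# List-encoded integer polynomials for large cyclotomic torsion certificates (reflection)

Topic `Literature/NumberTheory/EllipticCurves`, namespace `Literature.NumberTheory.EllipticCurves.CyclotomicTorsionSign.ListPoly`.
Definitions (with bodies) and their evaluation lemmas.  For the certificate of Gross's curve `A(163)` (a `163`-torsion point over
`ℚ(ζ₁₆₃)`, coordinates of degree `161` in `ζ`), the identities modulo `Φ₁₆₃` are too large for `ring`/`linear_combination` on explicit
expressions; instead the polynomials are coefficient LISTS (`List ℤ`, constant term first), their arithmetic (`addL`, `smulL`, `mulL`) is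
computed by the kernel (`decide`), and `evalL ζ` transports an identity of lists `mulL A B = addL C (mulL K Φ)` to the field:
`evalL_mulL`, `evalL_addL`, `evalL_smulL`, `evalL_eq_zero_of_isZeroL`.  Horner evaluation: `evalL ζ [c₀, c₁, …] = c₀ + ζ (c₁ + ζ (…))`.
Nothing about BSD is proved here.

## References
* J. H. Silverman, *The Arithmetic of Elliptic Curves*, 2nd ed. (2009), III.2.3 (the identities being certified). [SilvermanAEC2009]
* B. Grégoire, A. Mahboubi, *Proving equalities in a commutative ring done right in Coq*, TPHOLs 2005 (proof by reflection for ring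
  identities — the method). [folklore]

## Mathlib / tree search
Mathlib: `List.zipWith`, `List.map`, `List.foldr`; no list-polynomial reflection found (`lean search 'evalL|List.*Horner'`: none);
`Polynomial ℤ` is not kernel-computable (Finsupp).  Tree: `CyclotomicTorsionSign` (consumer).
-/

namespace Literature.NumberTheory.EllipticCurves

namespace CyclotomicTorsionSign

namespace ListPoly

/-- Horner evaluation of an integer coefficient list (constant term first) at `ζ`. [cite: SilvermanAEC2009, III.2.3] -/
def evalL {F : Type*} [CommRing F] (ζ : F) : List ℤ → F
  | [] => 0
  | c :: l => (c : F) + ζ * evalL ζ l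

/-- Coefficientwise sum of two lists (the shorter one padded with zeros). [cite: SilvermanAEC2009, III.2.3] -/
def addL : List ℤ → List ℤ → List ℤ
  | [], m => m
  | l, [] => l
  | c :: l, d :: m => (c + d) :: addL l m

/-- Scalar multiple of a list. [cite: SilvermanAEC2009, III.2.3] -/
def smulL (c : ℤ) (l : List ℤ) : List ℤ := l.map (c * ·)

/-- Product of two coefficient lists (convolution). [cite: SilvermanAEC2009, III.2.3] -/
def mulL : List ℤ → List ℤ → List ℤ
  | [], _ => []
  | c :: l, m => addL (smulL c m) (0 :: mulL l m)

/-- All coefficients vanish. [cite: SilvermanAEC2009, III.2.3] -/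
def isZeroL (l : List ℤ) : Bool := l.all (· == 0)

variable {F : Type*} [CommRing F] (ζ : F)

/-- `evalL ζ [] = 0`. [cite: SilvermanAEC2009, III.2.3] -/
@[simp] theorem evalL_nil : evalL ζ [] = 0 := rfl

/-- `evalL ζ (c :: l) = c + ζ · evalL ζ l`. [cite: SilvermanAEC2009, III.2.3] -/
@[simp] theorem evalL_cons (c : ℤ) (l : List ℤ) : evalL ζ (c :: l) = (c : F) + ζ * evalL ζ l := rfl

/-- `evalL` is additive. [cite: SilvermanAEC2009, III.2.3] -/
theorem evalL_addL (l m : List ℤ) : evalL ζ (addL l m) = evalL ζ l + evalL ζ m := by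
  induction l generalizing m with
  | nil => simp [addL]
  | cons c l ih =>
    cases m with
    | nil => simp [addL]
    | cons d m => simp only [addL, evalL_cons, ih, Int.cast_add]; ring

/-- `evalL` commutes with scalars. [cite: SilvermanAEC2009, III.2.3] -/
theorem evalL_smulL (c : ℤ) (l : List ℤ) : evalL ζ (smulL c l) = (c : F) * evalL ζ l := by
  induction l with
  | nil => simp [smulL]
  | cons d l ih =>
    simp only [smulL, List.map_cons] at ih ⊢
    rw [evalL_cons, evalL_cons, ih, Int.cast_mul]; ring

/-- `evalL` is multiplicative. [cite: SilvermanAEC2009, III.2.3] -/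
theorem evalL_mulL (l m : List ℤ) : evalL ζ (mulL l m) = evalL ζ l * evalL ζ m := by
  induction l with
  | nil => simp [mulL]
  | cons c l ih => rw [mulL, evalL_addL, evalL_smulL, evalL_cons, ih, evalL_cons, Int.cast_zero, zero_add]; ring

/-- A list of zeros evaluates to `0`. [cite: SilvermanAEC2009, III.2.3] -/
theorem evalL_eq_zero_of_isZeroL {l : List ℤ} (h : isZeroL l = true) : evalL ζ l = 0 := by
  induction l with
  | nil => rfl
  | cons c l ih =>
    simp only [isZeroL, List.all_cons, Bool.and_eq_true, beq_iff_eq] at h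
    rw [evalL_cons, h.1, ih (by simpa [isZeroL] using h.2), Int.cast_zero, mul_zero, add_zero]

/-- **Transport of a certified identity**: if `isZeroL (addL (mulL A B) (addL (smulL (-1) C) (mulL K Φ)))`, i.e. `A·B − C + K·Φ = 0`
coefficientwise, and `Φ(ζ) = 0`, then `A(ζ)·B(ζ) = C(ζ)`. [cite: SilvermanAEC2009, III.2.3] -/
theorem eval_mul_eq_of_cert {A B C K Φ : List ℤ} (hΦ : evalL ζ Φ = 0)
    (h : isZeroL (addL (mulL A B) (addL (smulL (-1) C) (mulL K Φ))) = true) :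
    evalL ζ A * evalL ζ B = evalL ζ C := by
  have h0 := evalL_eq_zero_of_isZeroL ζ h
  rw [evalL_addL, evalL_addL, evalL_mulL, evalL_smulL, evalL_mulL, hΦ, mul_zero, add_zero, Int.cast_neg, Int.cast_one] at h0
  linear_combination h0

/-- Transport, linear form: if `A − C + K·Φ = 0` coefficientwise and `Φ(ζ) = 0` then `A(ζ) = C(ζ)`. [cite: SilvermanAEC2009, III.2.3] -/
theorem eval_eq_of_cert {A C K Φ : List ℤ} (hΦ : evalL ζ Φ = 0)
    (h : isZeroL (addL A (addL (smulL (-1) C) (mulL K Φ))) = true) : evalL ζ A = evalL ζ C := by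
  have h0 := evalL_eq_zero_of_isZeroL ζ h
  rw [evalL_addL, evalL_addL, evalL_smulL, evalL_mulL, hΦ, mul_zero, add_zero, Int.cast_neg, Int.cast_one] at h0
  linear_combination h0

/-- The all-ones list of length `n` evaluates to the geometric sum `1 + ζ + ⋯ + ζ^{n−1}`. [cite: SilvermanAEC2009, III.2.3] -/
theorem evalL_replicate_one (n : ℕ) : evalL ζ (List.replicate n 1) = ∑ i ∈ Finset.range n, ζ ^ i := by
  induction n with
  | zero => simp
  | succ n ih =>
    rw [List.replicate_succ, evalL_cons, ih, Finset.sum_range_succ', Int.cast_one, Finset.mul_sum, pow_zero, add_comm]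
    refine congrArg (· + (1 : F)) (Finset.sum_congr rfl fun i _ ↦ ?_)
    rw [pow_succ]; ring

/-- A ring homomorphism fixing `ζ` fixes every `evalL ζ l`. [cite: SilvermanAEC2009, III.2.3] -/
theorem map_evalL {F' : Type*} [CommRing F'] (φ : F →+* F') (l : List ℤ) : φ (evalL ζ l) = evalL (φ ζ) l := by
  induction l with
  | nil => simp
  | cons c l ih => rw [evalL_cons, evalL_cons, map_add, map_mul, map_intCast, ih]

end ListPoly

end CyclotomicTorsionSign

end Literature.NumberTheory.EllipticCurves
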